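import Summits.BirchSwinnertonDyer.Rank1Residual.X2.RankOneHeegnerExact
import Summits.BirchSwinnertonDyer.Rank1Residual.X11b.ChaPairsMinimality
import Summits.BirchSwinnertonDyer.Rank1Residual.X1.CongruenceTransfer
import Summits.BirchSwinnertonDyer.Rank1Residual.Partition.EisensteinKernelCertificate
import Summits.BirchSwinnertonDyer.BirchSwinnertonDyer.Theorems.Rank1ResidualIntModelReduction
import Summits.BirchSwinnertonDyer.BirchSwinnertonDyer.Theorems.Rank1ResidualX11RankOneReduction
import Summits.BirchSwinnertonDyer.Rank1Residual.Supersingular.IntModelMinimalityKrausTwoMore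
import Literature.NumberTheory.EllipticCurves.PAdicHeights
import Literature.NumberTheory.EllipticCurves.ThreeIsogenyKernelX
import Literature.NumberTheory.EllipticCurves.IsogenyVariableChangeProofs
import Literature.NumberTheory.EllipticCurves.IsogenyCompProofs
import Summits.BirchSwinnertonDyer.Rank1Residual.X2.RouteGSplitDisplay439593n2Local
import HarnessLib

/-!
# ROAD II (planner bsd-eis-plan g10 FINDING F7 sketch, landed by seat bsd-eis-ky g5) — ROAD II assembled for the BOTH-HOLD A10/K5-split cell `439593n1` (p = 3)
#
# DIAGNOSIS (F7): eng-2's token λ-minimal relative `2541j2` is an EXACT E[3]-relative of the class member `439593n2`,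
# not of `439593n1` (different eng-2 gid / Hesse pencils; ky's `routeg_gen.py` therefore found «no Hesse certificate»).
# ROAD II: route G (ky's `RouteGSplitDisplay…` machinery) lands `X2.MazurMainConjectureAt 439593n2 3`; THIS FILE carries it
# to the cell's curve `439593n1` by the tree's `X2.mazurMainConjectureAt_of_isIsogenous` (X2/RankOneHeegnerExact.lean,
# appendix gen 3: MC ⟹ BSD(p) ⟹ Cassels ⟹ BSD(p) ⟹ MC at analytic rank 0), with IN THE KERNEL: the two minimal models
# are elliptic and globally minimal (Kraus, factored), `439593n2` is split multiplicative at 3 (node-tangent root t = 1)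
# and has reducible E[3] (rational Ψ₃-root x₀ = 3992/3), and the `3`-ISOGENY CERTIFICATE `439593n2 ~ 439593n1`
# (C₁ = ⟨1, 3992/3, 0, -1/2⟩ · Vélu `IsKernelXThreePair` · C₂ = ⟨3, -1328, 0, 27/2⟩; `HOME/plan-g10/f7/gen_transport7.py`).
# BINDERS left: the [PUB] facts of the transport theorem (thm16, Jones/JSW thm61 split+nonsplit, canonical heights ×2,
# GZK, newform, modular parametrisation, Cassels `bsdRHS_eq_of_isIsogenous`, Greenberg–Stevens) and ONE [CERT]
# `analyticRank 439593n1 = 0` (L(E,1) ≠ 0; Cremona allbsd r = 0). Nothing booked.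
LANDING NOTE (ky g5): the member-`k` lemmas `isElliptic_439593n2`, `isGloballyMinimal_439593n2`, `split_439593n2`, `not_irreducible_439593n2` are REUSED from the landed route-G display `X2/RouteGSplitDisplay439593n2Local.lean` (same statements; `dedup.landed`), everything else is the planner's file verbatim.
-/

set_option autoImplicit false

noncomputable section

open scoped Classical MatrixGroups ModularForm

open CongruenceSubgroup WeierstrassCurve NumberField Literature.NumberTheory.EllipticCurves
  Literature.NumberTheory.EllipticCurves.ModularForms Literature.NumberTheory.QuadraticFields
  Literature.NumberTheory.EllipticCurves.Wuthrich2014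
  Literature.NumberTheory.EllipticCurves.SteinWuthrich2013
  Literature.NumberTheory.EllipticCurves.KrizLi2019
  Literature.NumberTheory.EllipticCurves.GreenbergVatsal2000
  Literature.NumberTheory.EllipticCurves.Rank1Residual
  Literature.NumberTheory.EllipticCurves.Rank1Residual.Typed
  Literature.NumberTheory.EllipticCurves.Rank1Residual.X11RankOneCertificates
  Summit.BirchSwinnertonDyer.Rank1Residual
  Summit.BirchSwinnertonDyer.Rank1Residual.X1.CongruenceTransfer
  Summit.BirchSwinnertonDyer.BirchSwinnertonDyer.Rank1Residual.IntModel
  Summit.BirchSwinnertonDyer.BirchSwinnertonDyer.Rank1Residual.X11RankOne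
  Summit.BirchSwinnertonDyer.Rank1Residual.X11b
  Summit.BirchSwinnertonDyer.Rank1Residual.Supersingular
  Summit.BirchSwinnertonDyer.Rank1Residual.X1.MuLambda
  Summit.BirchSwinnertonDyer.Rank1Residual.X1.ParitySqueeze

open Summit.BirchSwinnertonDyer.Rank1Residual.X2.RouteGSplitDisplay439593n2Local

namespace Summit.BirchSwinnertonDyer.Rank1Residual.X2.RouteGMemberK439593n1

/-! ## §1 The two minimal models -/

/-- `439593n1 = [0, 1, 1, -722289, -236626351]` is elliptic (`Δ ≠ 0`). [folklore] -/
theorem isElliptic_439593n1 : (⟨0, 1, 1, (-722289), (-236626351)⟩ : WeierstrassCurve ℚ).IsElliptic :=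
  X11b.isElliptic_of_discOf_ne_zero 0 1 1 (-722289) (-236626351) (by decide +kernel)

/-- `439593n1` is globally minimal: `|Δ| = 3^6 · 7^1 · 11^10 · 173^1` and the extended Kraus criterion prime by prime
(tree `isGloballyMinimal_of_krausCriterion₃_factored`). [cite: SilvermanAEC2009, VII.1 Remark 1.1] [cite: Cremona1997, ecdata/allcurves (439593n1)] -/
theorem isGloballyMinimal_439593n1 : (⟨0, 1, 1, (-722289), (-236626351)⟩ : WeierstrassCurve ℚ).IsGloballyMinimal :=
  isGloballyMinimal_of_krausCriterion₃_factored 0 1 1 (-722289) (-236626351)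
    [(3, 6), (7, 1), (11, 10), (173, 1)] (by decide +kernel)
    (by intro qe hqe; simp only [List.mem_cons, List.not_mem_nil, or_false] at hqe
        rcases hqe with rfl | rfl | rfl | rfl <;> norm_num)
    (by set_option synthInstance.maxSize 2000 in decide +kernel)

/-! ## §2 Local data of `439593n2` at `3`: split multiplicative, reducible `E[3]` -/

/-! ## §3 The `3`-isogeny certificate `439593n2 ~ 439593n1` -/

/-- The Vélu source model `V = C₁ • 439593n2` (`x = 0` is a rational `Ψ₃`-root: `b² = 4ac`). [folklore] -/
def V : WeierstrassCurve ℚ := ⟨0, 3993, 0, (17730251 / 3 : ℚ), (236184673571 / 108 : ℚ)⟩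

/-- Vélu's quotient `V' = V/⟨(0, ±√c)⟩ = [0, a, 0, −9b, −(27c + 8ab)]`. [cite: CremonaAlgorithms1997, §3.8] -/
def V' : WeierstrassCurve ℚ := ⟨0, 3993, 0, (-53190753), (-991351524163 / 4 : ℚ)⟩

/-- `C₁ • 439593n2 = V`. [folklore] -/
theorem smul_memberk_eq_V :
    (⟨Units.mk0 (1 : ℚ) (by norm_num), (3992 / 3 : ℚ), 0, (-1 / 2 : ℚ)⟩ : VariableChange ℚ) •
      (⟨0, 1, 1, 595401, (-963332386)⟩ : WeierstrassCurve ℚ) = V := by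
  ext <;> simp only [variableChange_a₁, variableChange_a₂, variableChange_a₃, variableChange_a₄,
    variableChange_a₆, Units.val_inv_eq_inv_val, Units.val_mk0, V] <;> norm_num

/-- `C₂ • V' = 439593n1`. [folklore] -/
theorem smul_V'_eq_member1 :
    (⟨Units.mk0 3 (by norm_num), (-1328), 0, (27 / 2 : ℚ)⟩ : VariableChange ℚ) • V' =
      (⟨0, 1, 1, (-722289), (-236626351)⟩ : WeierstrassCurve ℚ) := by
  ext <;> simp only [variableChange_a₁, variableChange_a₂, variableChange_a₃, variableChange_a₄,
    variableChange_a₆, Units.val_inv_eq_inv_val, Units.val_mk0, V'] <;> norm_num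

/-- `V → V'` is Vélu's `3`-isogeny with kernel `{O, (0, ±√c)}` (`IsKernelXThreePair`). [cite: CremonaAlgorithms1997, §3.8] -/
theorem isKernelXThreePair_V : IsKernelXThreePair 3993 (17730251 / 3 : ℚ) (236184673571 / 108 : ℚ) V V' where
  a₁_eq := rfl
  a₂_eq := rfl
  a₃_eq := rfl
  a₄_eq := rfl
  a₆_eq := rfl
  a₁'_eq := rfl
  a₂'_eq := rfl
  a₃'_eq := rfl
  a₄'_eq := by simp only [V']; norm_num
  a₆'_eq := by simp only [V']; norm_num
  rel := by norm_num
  Δ_ne := by norm_num [V, WeierstrassCurve.Δ, WeierstrassCurve.b₂, WeierstrassCurve.b₄, WeierstrassCurve.b₆, WeierstrassCurve.b₈]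

/-- **`439593n2 ~ 439593n1` over `ℚ` — IN THE KERNEL.** [cite: Cremona1997, ecdata/allisog (class 439593n)] -/
theorem isIsogenous_439593n2_439593n1 :
    IsIsogenous (⟨0, 1, 1, 595401, (-963332386)⟩ : WeierstrassCurve ℚ) ⟨0, 1, 1, (-722289), (-236626351)⟩ :=
  ((isIsogenous_of_smul_eq smul_memberk_eq_V).trans' isKernelXThreePair_V.isIsogenous).trans'
    (isIsogenous_of_smul_eq smul_V'_eq_member1)

/-! ## §4 ROAD II transport: MC at `439593n2` ⟹ MC at `439593n1` -/

/-- **ROAD II for the cell `439593n1@3`**: Mazur's main conjecture at `(439593n2, 3)` (route G from the exact λ-minimal relative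
`2541j2`) implies it at `(439593n1, 3)` — `X2.mazurMainConjectureAt_of_isIsogenous` along the kernel-certified 3-isogeny,
modulo the listed [PUB] facts and the analytic-rank-0 certificate of `439593n1`. [cite: Wuthrich2014, Thm. 16 and Lemma 17 (p. 397)]
[cite: MilneADT2006, Thm. I.7.3] [cite: GreenbergVatsal2000, Thm. (1.3)] -/
theorem mazurMainConjectureAt_439593n1_of_memberk
    (hWu : thm16_charIdeal_dvd_multiplicative_of_reducible)
    (hJs : thm61_splitMultiplicative) (hJn : thm61_nonsplitMultiplicative)
    (hHs : exists_isSplitMultCanonical) (hHn : exists_isMultCanonical)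
    (hGZK : rank_eq_analyticRank_of_analyticRank_le_one) (hnf : exists_isNewformOf)
    (hpar : nonempty_modularParametrizationData) (hCassels : bsdRHS_eq_of_isIsogenous)
    (hGS : ∀ (W : WeierstrassCurve ℚ) [W.IsElliptic] [W.IsGloballyMinimal] (p : ℕ) [Fact p.Prime],
      greenberg_stevens (W := W) (p := p))
    (Wk W₁ : WeierstrassCurve ℚ) [Wk.IsElliptic] [Wk.IsGloballyMinimal] [W₁.IsElliptic] [W₁.IsGloballyMinimal]
    (hk : Wk = ⟨0, 1, 1, 595401, (-963332386)⟩) (h₁ : W₁ = ⟨0, 1, 1, (-722289), (-236626351)⟩)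
    (hr : W₁.analyticRank = 0) (hMC : X2.MazurMainConjectureAt Wk 3) :
    X2.MazurMainConjectureAt W₁ 3 := by
  subst hk h₁
  haveI : Fact (Nat.Prime 3) := ⟨by norm_num⟩
  have hiso := isIsogenous_439593n2_439593n1
  have hrk : (⟨0, 1, 1, 595401, (-963332386)⟩ : WeierstrassCurve ℚ).analyticRank = 0 := by
    rw [analyticRank_eq_of_isIsogenous' hiso]; exact hr
  exact X2.mazurMainConjectureAt_of_isIsogenous hWu hJs hJn hHs hHn hGZK hnf hpar hCassels hGS hiso 3 (by decide)
    split_439593n2.hasMultiplicativeReductionAtPrime not_irreducible_439593n2 hrk hMC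

end Summit.BirchSwinnertonDyer.Rank1Residual.X2.RouteGMemberK439593n1

end
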